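import Mathlib.Analysis.ODE.Gronwall
import Mathlib.Analysis.ODE.ExistUnique
import Mathlib.Analysis.SpecialFunctions.Log.Basic
import Mathlib.Analysis.Calculus.Deriv.Shift
import Mathlib.Algebra.Order.Floor.Semiring
import Literature.Analysis.ODE.LinearGrowth
import HarnessLib

/-!
# Floquet multipliers of a periodic linear system and the exponential rate of its solutions
# (Floquet 1883; Chicone, *Ordinary Differential Equations with Applications*, §2.4)

Topic `Literature/Analysis/ODE` (namespace `Literature.Analysis.ODE.Floquet`). For the
`T`-periodic linear system `x' = A(t) x` on a real Banach space `E` (`A : ℝ → E →L[ℝ] E`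
continuous, `A (t + T) = A t`), the classical facts of Floquet theory that turn a
**characteristic multiplier** into a **growth rate**, in the form in which they are consumed by
certified (interval-arithmetic) computations of a monodromy matrix — everything PROVED, no named
facts:

* §1 (pure real analysis, no differential equation): a continuous `f` with
  `‖f (t + T)‖ = r ‖f t‖` for `t ≥ 0` (`T, r > 0`) obeys the TWO-SIDED exponential law
  `c e^{σ t} ≤ ‖f t‖ ≤ C e^{σ t}` on `t ≥ 0` with `σ = (log r)/T`, `C = (max_{[0,T]} ‖f‖) e^{|log r|}`
  and, if `f` has no zero on `[0, T]`, `c = (min_{[0,T]} ‖f‖) e^{−|log r|} > 0`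
  (`norm_le_exp_of_norm_add_period`, `exp_le_norm_of_norm_add_period`).
* §2 Chicone Thm 2.83 (Floquet), first display, for ONE solution: periodicity of `A` makes
  `t ↦ v (t + T)` a solution (`hasDerivAt_comp_add_period`), so by uniqueness
  (`eq_of_hasDerivAt`, from Mathlib's `ODE_solution_unique_of_mem_Ioo` with the Lipschitz
  constant `max_{[-R,R]} ‖A‖`) a solution with `v T = ρ • v 0` satisfies `v (t + T) = ρ • v t`
  for ALL `t` (`apply_add_period_eq_smul`; Chicone Thm 2.95 "for this solution
  `x(t + T) = λ x(t)`"), never vanishes if `v 0 ≠ 0` (`ne_zero_of_apply_ne_zero`), and hence —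
  §1 with `r = |ρ|` — grows or decays at the exact exponential rate `σ = log |ρ| / T` with
  two-sided constants (`floquet_twoSided_bounds`; the discussion after Chicone Thm 2.96: a
  positive real multiplier `λ > 1` gives a solution "unbounded as `t → ∞`", `λ < 1` one
  "asymptotic to the zero solution"; a negative real multiplier likewise with `|λ|`):
  `tendsto_norm_atTop_of_one_lt_abs`, `tendsto_zero_of_abs_lt_one` (Chicone Thm 2.89 (3)/(1) for
  the Floquet solution itself).
* §3 The **solution operator and the monodromy operator** (Chicone p. 202: "the operator
  `v ↦ Φ(T+τ)Φ⁻¹(τ)v` is called a monodromy operator"; Prop. 2.84 (1) "every monodromy operator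
  is invertible"): global solutions exist (the tree's
  `Literature.Analysis.ODE.exists_solution_of_linearGrowth_at`, Hartman IV Lemma 1.1), so
  `evolution hA x₀` (the solution through `x₀` at `t = 0`) and the linear map
  `monodromy hA T : E →ₗ[ℝ] E`, `x₀ ↦ evolution hA x₀ T`, are DEFINED; `monodromy_injective`;
  Floquet's relation `evolution hA x (t + T) = evolution hA (monodromy hA T x) t`
  (`evolution_add_period`, Chicone (2.83) `Φ(t+T) = Φ(t)Φ⁻¹(0)Φ(T)`) and its iterate
  `evolution_add_nat_mul_period`; an EIGENVECTOR of the monodromy with real eigenvalue `ρ`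
  (a real characteristic multiplier) yields the Floquet solution of §2 with its two-sided
  exponential law (`floquet_twoSided_bounds_of_eigenvector`, Chicone Thm 2.95).
* §4 Grönwall on one period (`norm_evolution_le`: `‖evolution hA x t‖ ≤ ‖x‖ e^{K t}` on `[0, T]`
  when `‖A‖ ≤ K` there) and the quantitative form of Chicone Thm 2.89 (1): a power bound
  `‖Mⁿ x‖ ≤ C rⁿ ‖x‖` on the monodromy (`r > 0`; what a certified spectral computation delivers)
  bounds EVERY solution, `‖v t‖ ≤ C' ‖v 0‖ e^{(log r / T) t}` for `t ≥ 0`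
  (`norm_le_of_monodromy_pow_le`).

WHAT IS NOT HERE: the Floquet normal form `Φ(t) = P(t) e^{tB}` (matrix logarithms, Chicone
Thm 2.82), complex multipliers (a complex-conjugate pair needs an adapted norm on its real
invariant plane), Lyapunov exponents (Chicone Prop. 2.101). The cell-side use (Kelvin modes on a
periodic wave-vector orbit: a certified real multiplier `|ρ| > 1` of Bayly's Floquet system ⇒ an
exact Navier–Stokes solution growing at rate `log|ρ|/T`) is in
`Literature/Analysis/FluidPDE/KelvinModeFloquet.lean`.

## References

* G. Floquet, "Sur les équations différentielles linéaires à coefficients périodiques",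
  *Ann. Sci. ÉNS* (2) 12 (1883) 47–88. [`Floquet1883`]
* C. Chicone, *Ordinary Differential Equations with Applications*, 2nd ed., Texts in Applied
  Mathematics 34, Springer (2006), §2.4 "Floquet theory": Thm 2.83, Prop. 2.84, Thm 2.89,
  Lemma 2.94, Thm 2.95–2.96 and the discussion following (held:
  `book:chiconend-ordinary-differential-equations-with-applications`, chunks p0200–p0211).
  [`Chicone2006`]
* P. Hartman, *Ordinary Differential Equations*, SIAM Classics 38 (2002), Ch. IV Lemma 1.1
  (global existence for linear systems; tree: `LinearGrowth.lean`). [`Hartman2002`]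
-/

noncomputable section

open Set Filter Metric Topology
open scoped NNReal

namespace Literature.Analysis.ODE

namespace Floquet

/-! ### §1 The functional equation `‖f (t + T)‖ = r ‖f t‖`: two-sided exponential law -/

section FunctionalEquation

variable {E : Type*} [NormedAddCommGroup E]

/-- Iterating the period relation: `‖f (t + n T)‖ = rⁿ ‖f t‖` for `t ≥ 0` (Chicone, proof of
Thm 2.83: "`Φ(t + 2T) = Φ(t) C²`"). [cite: Chicone2006, §2.4 Thm 2.83 (proof)] -/
theorem norm_add_nat_mul_period {f : ℝ → E} {T r : ℝ} (hT : 0 ≤ T)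
    (h : ∀ t, 0 ≤ t → ‖f (t + T)‖ = r * ‖f t‖) :
    ∀ (n : ℕ) (t : ℝ), 0 ≤ t → ‖f (t + n * T)‖ = r ^ n * ‖f t‖ := by
  intro n
  induction n with
  | zero => intro t _; simp
  | succ k ih =>
    intro t ht
    have hk : 0 ≤ t + k * T := by positivity
    have e : t + ((k + 1 : ℕ) : ℝ) * T = (t + k * T) + T := by push_cast; ring
    rw [e, h _ hk, ih t ht, pow_succ]
    ring

/-- Euclidean division of a time `t ≥ 0` by the period: `t = s + n T`, `0 ≤ s < T`, and the
integer part is within one of `t / T`. [folklore] -/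
private theorem exists_floor_decomp {T t : ℝ} (hT : 0 < T) (ht : 0 ≤ t) :
    ∃ (n : ℕ) (s : ℝ), 0 ≤ s ∧ s < T ∧ t = s + n * T ∧ |(n : ℝ) - t / T| ≤ 1 := by
  have h1 : (⌊t / T⌋₊ : ℝ) ≤ t / T := Nat.floor_le (div_nonneg ht hT.le)
  have h2 : t / T < ⌊t / T⌋₊ + 1 := Nat.lt_floor_add_one (t / T)
  refine ⟨⌊t / T⌋₊, t - ⌊t / T⌋₊ * T, ?_, ?_, by ring, ?_⟩
  · have : (⌊t / T⌋₊ : ℝ) * T ≤ t := by rwa [le_div_iff₀ hT] at h1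
    linarith
  · have : t < (⌊t / T⌋₊ + 1) * T := by rwa [div_lt_iff₀ hT] at h2
    linarith
  · rw [abs_le]; constructor <;> linarith

/-- `rⁿ` versus `e^{(log r / T) t}` when `|n − t/T| ≤ 1`: they agree up to the factor `e^{±|log r|}`.
[folklore] -/
private theorem pow_bounds_of_abs_sub_le_one {r T t : ℝ} (hr : 0 < r) (hT : 0 < T) {n : ℕ}
    (hn : |(n : ℝ) - t / T| ≤ 1) :
    Real.exp (-|Real.log r|) * Real.exp (Real.log r / T * t) ≤ r ^ n ∧
      r ^ n ≤ Real.exp |Real.log r| * Real.exp (Real.log r / T * t) := by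
  have hrn : r ^ n = Real.exp (n * Real.log r) := by
    rw [Real.exp_nat_mul, Real.exp_log hr]
  have hkey : |n * Real.log r - Real.log r / T * t| ≤ |Real.log r| := by
    have e : n * Real.log r - Real.log r / T * t = Real.log r * (n - t / T) := by
      field_simp
    rw [e, abs_mul]
    exact mul_le_of_le_one_right (abs_nonneg _) hn
  rw [hrn, ← Real.exp_add, ← Real.exp_add]
  obtain ⟨h1, h2⟩ := abs_le.mp hkey
  constructor <;> apply Real.exp_le_exp.mpr <;> linarith

/-- **Upper exponential law.** If `f` is continuous on `[0, T]` (`T > 0`) and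
`‖f (t + T)‖ = r ‖f t‖` for all `t ≥ 0` (`r > 0`), then `‖f t‖ ≤ C e^{(log r / T) t}` for `t ≥ 0`,
with `C = (sup_{[0,T]} ‖f‖) · e^{|log r|}`. [cite: Chicone2006, §2.4, discussion following Thm 2.96] -/
theorem norm_le_exp_of_norm_add_period {f : ℝ → E} {T r : ℝ} (hT : 0 < T) (hr : 0 < r)
    (hf : ContinuousOn f (Icc 0 T)) (h : ∀ t, 0 ≤ t → ‖f (t + T)‖ = r * ‖f t‖) :
    ∃ C : ℝ, 0 ≤ C ∧ ∀ t, 0 ≤ t → ‖f t‖ ≤ C * Real.exp (Real.log r / T * t) := by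
  obtain ⟨M, hM⟩ := isCompact_Icc.exists_bound_of_continuousOn hf
  have hM0 : 0 ≤ M := (norm_nonneg _).trans (hM 0 ⟨le_rfl, hT.le⟩)
  refine ⟨M * Real.exp |Real.log r|, by positivity, fun t ht => ?_⟩
  obtain ⟨n, s, hs0, hsT, rfl, hn⟩ := exists_floor_decomp hT ht
  rw [norm_add_nat_mul_period hT.le h n s hs0]
  have hfs : ‖f s‖ ≤ M := hM s ⟨hs0, hsT.le⟩
  have hpow := (pow_bounds_of_abs_sub_le_one hr hT hn).2
  calc r ^ n * ‖f s‖ ≤ (Real.exp |Real.log r| * Real.exp (Real.log r / T * (s + n * T))) * M :=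
        mul_le_mul hpow hfs (norm_nonneg _) (by positivity)
    _ = M * Real.exp |Real.log r| * Real.exp (Real.log r / T * (s + n * T)) := by ring

/-- **Lower exponential law.** If moreover `f` has no zero on `[0, T]`, then
`c e^{(log r / T) t} ≤ ‖f t‖` for `t ≥ 0` with `c = (min_{[0,T]} ‖f‖) · e^{−|log r|} > 0`.
[cite: Chicone2006, §2.4, discussion following Thm 2.96] -/
theorem exp_le_norm_of_norm_add_period {f : ℝ → E} {T r : ℝ} (hT : 0 < T) (hr : 0 < r)
    (hf : ContinuousOn f (Icc 0 T)) (h0 : ∀ s ∈ Icc 0 T, f s ≠ 0)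
    (h : ∀ t, 0 ≤ t → ‖f (t + T)‖ = r * ‖f t‖) :
    ∃ c : ℝ, 0 < c ∧ ∀ t, 0 ≤ t → c * Real.exp (Real.log r / T * t) ≤ ‖f t‖ := by
  obtain ⟨s₀, hs₀, hmin⟩ :=
    isCompact_Icc.exists_isMinOn (nonempty_Icc.mpr hT.le) (hf.norm)
  have hm : 0 < ‖f s₀‖ := norm_pos_iff.mpr (h0 s₀ hs₀)
  refine ⟨‖f s₀‖ * Real.exp (-|Real.log r|), by positivity, fun t ht => ?_⟩
  obtain ⟨n, s, hs0, hsT, rfl, hn⟩ := exists_floor_decomp hT ht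
  rw [norm_add_nat_mul_period hT.le h n s hs0]
  have hfs : ‖f s₀‖ ≤ ‖f s‖ := hmin ⟨hs0, hsT.le⟩
  have hpow := (pow_bounds_of_abs_sub_le_one hr hT hn).1
  calc ‖f s₀‖ * Real.exp (-|Real.log r|) * Real.exp (Real.log r / T * (s + n * T))
        = (Real.exp (-|Real.log r|) * Real.exp (Real.log r / T * (s + n * T))) * ‖f s₀‖ := by
          ring
    _ ≤ r ^ n * ‖f s‖ := mul_le_mul hpow hfs hm.le (by positivity)

end FunctionalEquation

/-! ### §2 One solution with `v T = ρ • v 0`: the Floquet relation and its exponential rate -/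

section Solution

variable {E : Type*} [NormedAddCommGroup E] [NormedSpace ℝ E] {A : ℝ → E →L[ℝ] E}

/-- **Periodicity makes the shifted solution a solution** (Chicone, proof of Thm 2.83:
"`Ψ(t) := Φ(t + T)` … is a matrix solution"). [cite: Chicone2006, §2.4 Thm 2.83 (proof)] -/
theorem hasDerivAt_comp_add_period {T : ℝ} (hper : ∀ t, A (t + T) = A t) {v : ℝ → E}
    (hv : ∀ t, HasDerivAt v (A t (v t)) t) (t : ℝ) :
    HasDerivAt (fun s => v (s + T)) (A t (v (t + T))) t := by
  have h := HasDerivAt.comp_add_const t T (hv (t + T))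
  rwa [hper] at h

/-- A scalar multiple of a solution is a solution. [folklore] -/
private theorem hasDerivAt_const_smul {v : ℝ → E} (hv : ∀ t, HasDerivAt v (A t (v t)) t) (c : ℝ)
    (t : ℝ) : HasDerivAt (fun s => c • v s) (A t (c • v t)) t := by
  rw [map_smul]
  exact (hv t).const_smul c

/-- A sum of solutions is a solution. [folklore] -/
private theorem hasDerivAt_add {v w : ℝ → E} (hv : ∀ t, HasDerivAt v (A t (v t)) t)
    (hw : ∀ t, HasDerivAt w (A t (w t)) t) (t : ℝ) :
    HasDerivAt (fun s => v s + w s) (A t (v t + w t)) t := by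
  rw [map_add]
  exact (hv t).add (hw t)

/-- On a compact time interval a continuous coefficient is bounded, hence uniformly Lipschitz in
the state. [folklore] -/
private theorem exists_lipschitz_on_Icc (hA : Continuous A) (a b : ℝ) :
    ∃ K : ℝ≥0, ∀ t ∈ Icc a b, LipschitzWith K (A t) ∧ ∀ x, ‖A t x‖ ≤ K * ‖x‖ := by
  obtain ⟨C, hC⟩ := isCompact_Icc.exists_bound_of_continuousOn (hA.continuousOn (s := Icc a b))
  refine ⟨Real.toNNReal C, fun t ht => ?_⟩
  have hle : ‖A t‖ ≤ (Real.toNNReal C : ℝ) := (hC t ht).trans (Real.le_coe_toNNReal C)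
  refine ⟨(A t).lipschitz.weaken ?_, fun x => ?_⟩
  · change (‖A t‖₊ : ℝ≥0) ≤ Real.toNNReal C
    rw [← NNReal.coe_le_coe, coe_nnnorm]
    exact hle
  · exact ((A t).le_opNorm x).trans (mul_le_mul_of_nonneg_right hle (norm_nonneg _))

/-- **Uniqueness**: two global solutions of `x' = A(t) x` (`A` continuous) that agree at one time
agree everywhere (Grönwall; Mathlib's `ODE_solution_unique_of_mem_Ioo` with the Lipschitz
constant `max ‖A‖` on a compact interval containing both times).
[cite: Hartman2002, Ch. IV Lemma 1.1] -/
theorem eq_of_hasDerivAt (hA : Continuous A) {v w : ℝ → E}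
    (hv : ∀ t, HasDerivAt v (A t (v t)) t) (hw : ∀ t, HasDerivAt w (A t (w t)) t) {t₀ : ℝ}
    (heq : v t₀ = w t₀) : v = w := by
  funext t
  set R : ℝ := max |t| |t₀| + 1 with hR
  have htR : t ∈ Ioo (-R) R := by
    have h1 := neg_abs_le t; have h2 := le_abs_self t; have h3 := le_max_left |t| |t₀|
    constructor <;> linarith
  have ht₀R : t₀ ∈ Ioo (-R) R := by
    have h1 := neg_abs_le t₀; have h2 := le_abs_self t₀; have h3 := le_max_right |t| |t₀|
    constructor <;> linarith
  obtain ⟨K, hK⟩ := exists_lipschitz_on_Icc hA (-R) R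
  have hlip : ∀ s ∈ Ioo (-R) R, LipschitzOnWith K (fun x => A s x) (univ : Set E) := fun s hs =>
    ((hK s (Ioo_subset_Icc_self hs)).1).lipschitzOnWith
  exact ODE_solution_unique_of_mem_Ioo (v := fun s x => A s x) (s := fun _ => univ) hlip ht₀R
    (fun s _ => ⟨hv s, mem_univ _⟩) (fun s _ => ⟨hw s, mem_univ _⟩) heq htR

/-- A solution vanishing at one time vanishes identically; equivalently a solution with
`v t₀ ≠ 0` never vanishes. [cite: Hartman2002, Ch. IV Lemma 1.1] -/
theorem ne_zero_of_apply_ne_zero (hA : Continuous A) {v : ℝ → E}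
    (hv : ∀ t, HasDerivAt v (A t (v t)) t) {t₀ : ℝ} (h0 : v t₀ ≠ 0) (t : ℝ) : v t ≠ 0 := by
  intro ht
  have hz : ∀ s, HasDerivAt (fun _ : ℝ => (0 : E)) (A s ((fun _ : ℝ => (0 : E)) s)) s :=
    fun s => by simpa using hasDerivAt_const s (0 : E)
  have := eq_of_hasDerivAt hA hv hz (t₀ := t) (by simpa using ht)
  exact h0 (by simpa using congrFun this t₀)

/-- **Floquet's relation for one solution** (Chicone Thm 2.95: "for this solution
`x(t + T) = λ x(t)`"): if `A` is `T`-periodic and continuous and the global solution `v` satisfies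
`v T = ρ • v 0`, then `v (t + T) = ρ • v t` for every `t`. [cite: Chicone2006, §2.4 Thm 2.95] -/
theorem apply_add_period_eq_smul (hA : Continuous A) {T : ℝ} (hper : ∀ t, A (t + T) = A t)
    {v : ℝ → E} (hv : ∀ t, HasDerivAt v (A t (v t)) t) {ρ : ℝ} (hρ : v T = ρ • v 0) (t : ℝ) :
    v (t + T) = ρ • v t := by
  have h := eq_of_hasDerivAt hA (hasDerivAt_comp_add_period hper hv)
    (hasDerivAt_const_smul hv ρ) (t₀ := 0) (by simpa using hρ)
  exact congrFun h t

/-- Iterated Floquet relation: `v (t + n T) = ρⁿ • v t`. [cite: Chicone2006, §2.4 Thm 2.83 (proof)] -/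
theorem apply_add_nat_mul_period_eq_smul (hA : Continuous A) {T : ℝ}
    (hper : ∀ t, A (t + T) = A t) {v : ℝ → E} (hv : ∀ t, HasDerivAt v (A t (v t)) t) {ρ : ℝ}
    (hρ : v T = ρ • v 0) (n : ℕ) (t : ℝ) : v (t + n * T) = ρ ^ n • v t := by
  induction n with
  | zero => simp
  | succ k ih =>
    have e : t + ((k + 1 : ℕ) : ℝ) * T = (t + k * T) + T := by push_cast; ring
    rw [e, apply_add_period_eq_smul hA hper hv hρ, ih, smul_smul, pow_succ']

/-- The norm form of the Floquet relation: `‖v (t + T)‖ = |ρ| ‖v t‖`.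
[cite: Chicone2006, §2.4 Thm 2.95] -/
theorem norm_apply_add_period (hA : Continuous A) {T : ℝ} (hper : ∀ t, A (t + T) = A t)
    {v : ℝ → E} (hv : ∀ t, HasDerivAt v (A t (v t)) t) {ρ : ℝ} (hρ : v T = ρ • v 0) (t : ℝ) :
    ‖v (t + T)‖ = |ρ| * ‖v t‖ := by
  rw [apply_add_period_eq_smul hA hper hv hρ, norm_smul, Real.norm_eq_abs]

/-- **Two-sided exponential law of a Floquet solution.** Let `A` be continuous and `T`-periodic
(`T > 0`) and let the global solution `v` satisfy `v 0 ≠ 0` and `v T = ρ • v 0` with `ρ ≠ 0`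
(a real characteristic multiplier `ρ` with its Floquet solution). Then, with the Floquet exponent
`σ = log |ρ| / T`, there are constants `0 < c ≤ C` with
`c e^{σ t} ≤ ‖v t‖ ≤ C e^{σ t}` for all `t ≥ 0`. (Positive `ρ`: Chicone's "real nontrivial solution
`x(t) = e^{μt} r(t)`"; negative `ρ`: "`e^{νt}(r(t) cos(πt/T) − s(t) sin(πt/T))`", `e^{Tν} = |λ|`.)
[cite: Chicone2006, §2.4 Thm 2.95 and the discussion following Thm 2.96] -/
theorem floquet_twoSided_bounds (hA : Continuous A) {T : ℝ} (hT : 0 < T)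
    (hper : ∀ t, A (t + T) = A t) {v : ℝ → E} (hv : ∀ t, HasDerivAt v (A t (v t)) t)
    (h0 : v 0 ≠ 0) {ρ : ℝ} (hρ : ρ ≠ 0) (hvT : v T = ρ • v 0) :
    ∃ c C : ℝ, 0 < c ∧ c ≤ C ∧ ∀ t, 0 ≤ t →
      c * Real.exp (Real.log |ρ| / T * t) ≤ ‖v t‖ ∧
        ‖v t‖ ≤ C * Real.exp (Real.log |ρ| / T * t) := by
  have hcont : ContinuousOn v (Icc 0 T) := fun t _ => (hv t).continuousAt.continuousWithinAt
  have hrel : ∀ t, 0 ≤ t → ‖v (t + T)‖ = |ρ| * ‖v t‖ := fun t _ =>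
    norm_apply_add_period hA hper hv hvT t
  have hr : 0 < |ρ| := abs_pos.mpr hρ
  obtain ⟨C, -, hC⟩ := norm_le_exp_of_norm_add_period hT hr hcont hrel
  obtain ⟨c, hc, hcle⟩ := exp_le_norm_of_norm_add_period hT hr hcont
    (fun s _ => ne_zero_of_apply_ne_zero hA hv h0 s) hrel
  refine ⟨c, C, hc, ?_, fun t ht => ⟨hcle t ht, hC t ht⟩⟩
  have h := (hcle 0 le_rfl).trans (hC 0 le_rfl)
  simpa using h

/-- **A multiplier outside the closed unit disc gives an unbounded solution** (Chicone
Thm 2.89 (3) / p. 211: "if `λ > 1` … the solution is unbounded as `t → ∞`"): `|ρ| > 1` forces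
`‖v t‖ → ∞`. [cite: Chicone2006, §2.4 Thm 2.89 (3) and discussion following Thm 2.96] -/
theorem tendsto_norm_atTop_of_one_lt_abs (hA : Continuous A) {T : ℝ} (hT : 0 < T)
    (hper : ∀ t, A (t + T) = A t) {v : ℝ → E} (hv : ∀ t, HasDerivAt v (A t (v t)) t)
    (h0 : v 0 ≠ 0) {ρ : ℝ} (hρ : 1 < |ρ|) (hvT : v T = ρ • v 0) :
    Tendsto (fun t => ‖v t‖) atTop atTop := by
  have hρ0 : ρ ≠ 0 := abs_pos.mp (zero_lt_one.trans hρ)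
  obtain ⟨c, C, hc, -, hb⟩ := floquet_twoSided_bounds hA hT hper hv h0 hρ0 hvT
  have hσ : 0 < Real.log |ρ| / T := div_pos (Real.log_pos hρ) hT
  have hlow : Tendsto (fun t => c * Real.exp (Real.log |ρ| / T * t)) atTop atTop := by
    refine Tendsto.const_mul_atTop hc ?_
    exact Real.tendsto_exp_atTop.comp (tendsto_id.const_mul_atTop hσ)
  refine tendsto_atTop_mono' atTop ?_ hlow
  filter_upwards [eventually_ge_atTop (0 : ℝ)] with t ht using (hb t ht).1

/-- **A multiplier inside the open unit disc gives a decaying solution** (Chicone p. 211: "if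
`λ < 1` … the solution is asymptotic to the zero solution as `t → ∞`").
[cite: Chicone2006, §2.4 Thm 2.89 (1) and discussion following Thm 2.96] -/
theorem tendsto_zero_of_abs_lt_one (hA : Continuous A) {T : ℝ} (hT : 0 < T)
    (hper : ∀ t, A (t + T) = A t) {v : ℝ → E} (hv : ∀ t, HasDerivAt v (A t (v t)) t)
    (h0 : v 0 ≠ 0) {ρ : ℝ} (hρ0 : ρ ≠ 0) (hρ : |ρ| < 1) (hvT : v T = ρ • v 0) :
    Tendsto v atTop (𝓝 0) := by
  obtain ⟨c, C, hc, hcC, hb⟩ := floquet_twoSided_bounds hA hT hper hv h0 hρ0 hvT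
  have hσ : Real.log |ρ| / T < 0 := div_neg_of_neg_of_pos (Real.log_neg (abs_pos.mpr hρ0) hρ) hT
  have hup : Tendsto (fun t => C * Real.exp (Real.log |ρ| / T * t)) atTop (𝓝 (C * 0)) := by
    refine Tendsto.const_mul C ?_
    exact Real.tendsto_exp_atBot.comp (tendsto_id.const_mul_atTop_of_neg hσ)
  rw [mul_zero] at hup
  rw [tendsto_zero_iff_norm_tendsto_zero]
  refine squeeze_zero' (Eventually.of_forall fun t => norm_nonneg _) ?_ hup
  filter_upwards [eventually_ge_atTop (0 : ℝ)] with t ht using (hb t ht).2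

end Solution

/-! ### §3 The solution operator and the monodromy operator -/

section Monodromy

variable {E : Type*} [NormedAddCommGroup E] [NormedSpace ℝ E] [CompleteSpace E]
  {A : ℝ → E →L[ℝ] E}

/-- **Global existence for the linear system** `x' = A(t) x` with continuous coefficient, datum
at any time (Hartman IV Lemma 1.1, through the tree's `exists_solution_of_linearGrowth_at`;
Chicone Thm 2.4). [cite: Hartman2002, Ch. IV Lemma 1.1] -/
theorem exists_solution (hA : Continuous A) (t₀ : ℝ) (x₀ : E) :
    ∃ v : ℝ → E, v t₀ = x₀ ∧ ∀ t, HasDerivAt v (A t (v t)) t := by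
  refine exists_solution_of_linearGrowth_at (v := fun t x => A t x) (fun T => ?_)
    (fun x => hA.clm_apply continuous_const) t₀ x₀
  obtain ⟨K, hK⟩ := exists_lipschitz_on_Icc hA (-T) T
  exact ⟨K, fun t ht => hK t ht⟩

/-- **The solution operator**: `evolution hA x₀` is THE global solution of `x' = A(t) x` with
`x(0) = x₀` (Chicone's principal fundamental matrix solution at `t = 0` applied to `x₀`).
[cite: Chicone2006, §2.4 (monodromy operator, p. 202)] -/
def evolution (hA : Continuous A) (x₀ : E) : ℝ → E :=
  (exists_solution hA 0 x₀).choose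

/-- Initial value of the solution operator. [cite: Chicone2006, §2.4 (p. 202)] -/
theorem evolution_zero (hA : Continuous A) (x₀ : E) : evolution hA x₀ 0 = x₀ :=
  (exists_solution hA 0 x₀).choose_spec.1

/-- The solution operator solves the system. [cite: Chicone2006, §2.4 (p. 202)] -/
theorem hasDerivAt_evolution (hA : Continuous A) (x₀ : E) (t : ℝ) :
    HasDerivAt (evolution hA x₀) (A t (evolution hA x₀ t)) t :=
  (exists_solution hA 0 x₀).choose_spec.2 t

/-- The solution operator is continuous in time (solutions are `C¹`).
[cite: Hartman2002, Ch. IV §1 Lemma 1.1] -/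
theorem continuous_evolution (hA : Continuous A) (x₀ : E) : Continuous (evolution hA x₀) :=
  continuous_iff_continuousAt.mpr fun t => (hasDerivAt_evolution hA x₀ t).continuousAt

/-- Every global solution IS the solution operator applied to its initial value (uniqueness).
[cite: Hartman2002, Ch. IV Lemma 1.1] -/
theorem eq_evolution (hA : Continuous A) {v : ℝ → E} (hv : ∀ t, HasDerivAt v (A t (v t)) t) :
    v = evolution hA (v 0) :=
  eq_of_hasDerivAt hA hv (hasDerivAt_evolution hA (v 0)) (t₀ := 0) (evolution_zero hA (v 0)).symm

/-- **Superposition**: the solution operator is additive in the datum (the principal fundamental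
matrix acts linearly, Chicone p. 202 "`t ↦ Φ(t)Φ⁻¹(τ)v`"; Hartman IV §1).
[cite: Hartman2002, Ch. IV §1 Lemma 1.1 and Cor. 1.1] -/
theorem evolution_add (hA : Continuous A) (x y : E) :
    evolution hA (x + y) = fun t => evolution hA x t + evolution hA y t := by
  have h := eq_evolution hA (hasDerivAt_add (hasDerivAt_evolution hA x) (hasDerivAt_evolution hA y))
  simp only [evolution_zero] at h
  exact h.symm

/-- **Superposition**: the solution operator is homogeneous in the datum.
[cite: Hartman2002, Ch. IV §1 Lemma 1.1 and Cor. 1.1] -/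
theorem evolution_smul (hA : Continuous A) (c : ℝ) (x : E) :
    evolution hA (c • x) = fun t => c • evolution hA x t := by
  have h := eq_evolution hA (hasDerivAt_const_smul (hasDerivAt_evolution hA x) c)
  simp only [evolution_zero] at h
  exact h.symm

/-- **The monodromy operator** (period map, stroboscopic Poincaré map) of `x' = A(t) x` over
`[0, T]`: `x₀ ↦ x(T)`; a linear map. Its eigenvalues are the characteristic (Floquet)
multipliers. [cite: Chicone2006, §2.4 (monodromy operator, p. 202; characteristic multipliers,
p. 203)] -/
def monodromy (hA : Continuous A) (T : ℝ) : E →ₗ[ℝ] E where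
  toFun x := evolution hA x T
  map_add' x y := by simp only [evolution_add]
  map_smul' c x := by simp only [evolution_smul, RingHom.id_apply]

/-- Unfolding the monodromy operator. [cite: Chicone2006, §2.4 (p. 202)] -/
theorem monodromy_apply (hA : Continuous A) (T : ℝ) (x : E) :
    monodromy hA T x = evolution hA x T :=
  rfl

/-- **Every monodromy operator is injective** (Chicone Prop. 2.84 (1): "every characteristic
multiplier is nonzero"). [cite: Chicone2006, §2.4 Prop. 2.84 (1)] -/
theorem monodromy_injective (hA : Continuous A) (T : ℝ) : Function.Injective (monodromy hA T) := by
  refine (injective_iff_map_eq_zero _).mpr fun x hx => ?_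
  rw [monodromy_apply] at hx
  by_contra h
  have h0 : evolution hA x 0 ≠ 0 := by rwa [evolution_zero]
  exact ne_zero_of_apply_ne_zero hA (hasDerivAt_evolution hA x) h0 T hx

/-- A real characteristic multiplier (eigenvalue of the monodromy with a nonzero eigenvector) is
nonzero. [cite: Chicone2006, §2.4 Prop. 2.84 (1)] -/
theorem multiplier_ne_zero (hA : Continuous A) {T ρ : ℝ} {x₀ : E} (hx : x₀ ≠ 0)
    (heig : monodromy hA T x₀ = ρ • x₀) : ρ ≠ 0 := by
  rintro rfl
  rw [zero_smul] at heig
  exact hx (monodromy_injective hA T (by rw [heig, map_zero]))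

/-- **Floquet's theorem, first statement** (`Φ(t + T) = Φ(t) Φ⁻¹(0) Φ(T)`), applied to a datum:
for `T`-periodic `A`, the solution through `x` at time `t + T` is the solution through the
monodromy image `M x` at time `t`. [cite: Chicone2006, §2.4 Thm 2.83] -/
theorem evolution_add_period (hA : Continuous A) {T : ℝ} (hper : ∀ t, A (t + T) = A t) (x : E)
    (t : ℝ) : evolution hA x (t + T) = evolution hA (monodromy hA T x) t := by
  have h := eq_evolution hA (hasDerivAt_comp_add_period hper (hasDerivAt_evolution hA x))
  simpa [monodromy_apply] using congrFun h t

/-- Iterate: `Φ(t + nT) x = Φ(t) (Mⁿ x)` (Chicone: "`Φ(t + 2T) = Φ(t) C²`").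
[cite: Chicone2006, §2.4 Thm 2.83 (proof)] -/
theorem evolution_add_nat_mul_period (hA : Continuous A) {T : ℝ} (hper : ∀ t, A (t + T) = A t)
    (x : E) (n : ℕ) (t : ℝ) :
    evolution hA x (t + n * T) = evolution hA (((monodromy hA T) ^ n) x) t := by
  induction n generalizing x t with
  | zero => simp
  | succ k ih =>
    have e : t + ((k + 1 : ℕ) : ℝ) * T = (t + T) + k * T := by push_cast; ring
    rw [e, ih, evolution_add_period hA hper, pow_succ', Module.End.mul_apply]

/-- **A real eigenvector of the monodromy gives a Floquet solution with its two-sided exponential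
law** (Chicone Thm 2.95 + p. 211): if `M x₀ = ρ x₀`, `x₀ ≠ 0`, then the solution `v` through `x₀`
satisfies `v (t + T) = ρ • v t` and `c e^{σt} ≤ ‖v t‖ ≤ C e^{σt}` (`t ≥ 0`, `σ = log|ρ|/T`,
`c > 0`). This is the statement a CERTIFIED real multiplier is decoded by.
[cite: Chicone2006, §2.4 Thm 2.95 and the discussion following Thm 2.96] -/
theorem floquet_twoSided_bounds_of_eigenvector (hA : Continuous A) {T : ℝ} (hT : 0 < T)
    (hper : ∀ t, A (t + T) = A t) {ρ : ℝ} {x₀ : E} (hx : x₀ ≠ 0)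
    (heig : monodromy hA T x₀ = ρ • x₀) :
    (∀ t, evolution hA x₀ (t + T) = ρ • evolution hA x₀ t) ∧
      ∃ c C : ℝ, 0 < c ∧ c ≤ C ∧ ∀ t, 0 ≤ t →
        c * Real.exp (Real.log |ρ| / T * t) ≤ ‖evolution hA x₀ t‖ ∧
          ‖evolution hA x₀ t‖ ≤ C * Real.exp (Real.log |ρ| / T * t) := by
  have hvT : evolution hA x₀ T = ρ • evolution hA x₀ 0 := by
    rw [evolution_zero, ← monodromy_apply, heig]
  have h0 : evolution hA x₀ 0 ≠ 0 := by rwa [evolution_zero]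
  exact ⟨apply_add_period_eq_smul hA hper (hasDerivAt_evolution hA x₀) hvT,
    floquet_twoSided_bounds hA hT hper (hasDerivAt_evolution hA x₀) h0
      (multiplier_ne_zero hA hx heig) hvT⟩

/-! ### §4 All solutions: Grönwall over one period and power bounds on the monodromy -/

/-- **Grönwall over a time window**: if `‖A t‖ ≤ K` on `[0, T]` then
`‖evolution hA x t‖ ≤ ‖x‖ e^{K t}` there. [cite: Hartman2002, Ch. IV Lemma 1.1 (majorisation
`|y(t)| ≤ e^{K|t−t₀|}|y₀|`)] -/
theorem norm_evolution_le (hA : Continuous A) {T K : ℝ} (hK : ∀ t ∈ Icc 0 T, ‖A t‖ ≤ K) (x : E)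
    {t : ℝ} (ht : t ∈ Icc 0 T) : ‖evolution hA x t‖ ≤ ‖x‖ * Real.exp (K * t) := by
  have hcont : ContinuousOn (evolution hA x) (Icc 0 T) := (continuous_evolution hA x).continuousOn
  have hder : ∀ s ∈ Ico 0 T,
      HasDerivWithinAt (evolution hA x) (A s (evolution hA x s)) (Ici s) s := fun s _ =>
    (hasDerivAt_evolution hA x s).hasDerivWithinAt
  have hbound : ∀ s ∈ Ico 0 T, ‖A s (evolution hA x s)‖ ≤ K * ‖evolution hA x s‖ + 0 :=
    fun s hs => by
    rw [add_zero]
    exact ((A s).le_opNorm _).trans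
      (mul_le_mul_of_nonneg_right (hK s (Ico_subset_Icc_self hs)) (norm_nonneg _))
  have h := norm_le_gronwallBound_of_norm_deriv_right_le hcont hder
    (le_of_eq (by rw [evolution_zero])) hbound t ht
  rwa [gronwallBound_ε0, sub_zero] at h

/-- **Power bounds on the monodromy bound every solution** (the quantitative content of Chicone
Thm 2.89 (1): all multipliers of modulus `< 1` ⇒ asymptotic stability; here with the hypothesis in
the form `‖Mⁿ x‖ ≤ C rⁿ ‖x‖` a spectral-radius computation supplies): for `T`-periodic continuous
`A` (`T > 0`, `r > 0`) every solution obeys `‖v t‖ ≤ C' ‖v 0‖ e^{(log r / T) t}` for `t ≥ 0`.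
[cite: Chicone2006, §2.4 Thm 2.89 (1)] -/
theorem norm_le_of_monodromy_pow_le (hA : Continuous A) {T : ℝ} (hT : 0 < T)
    (hper : ∀ t, A (t + T) = A t) {C r : ℝ} (hr : 0 < r)
    (hM : ∀ (n : ℕ) (x : E), ‖((monodromy hA T) ^ n) x‖ ≤ C * r ^ n * ‖x‖)
    {v : ℝ → E} (hv : ∀ t, HasDerivAt v (A t (v t)) t) :
    ∃ C' : ℝ, 0 ≤ C' ∧ ∀ t, 0 ≤ t → ‖v t‖ ≤ C' * ‖v 0‖ * Real.exp (Real.log r / T * t) := by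
  obtain ⟨K, hK⟩ := isCompact_Icc.exists_bound_of_continuousOn (hA.continuousOn (s := Icc 0 T))
  have hK0 : 0 ≤ K := (norm_nonneg _).trans (hK 0 ⟨le_rfl, hT.le⟩)
  have hC₁ : 0 ≤ max C 0 := le_max_right _ _
  refine ⟨max C 0 * Real.exp (K * T) * Real.exp |Real.log r|, by positivity, fun t ht => ?_⟩
  obtain ⟨n, s, hs0, hsT, rfl, hn⟩ := exists_floor_decomp hT ht
  have hv' : v (s + n * T) = evolution hA (v 0) (s + n * T) := congrFun (eq_evolution hA hv) _
  have step1 : ‖v (s + n * T)‖ ≤ ‖((monodromy hA T) ^ n) (v 0)‖ * Real.exp (K * T) := by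
    rw [hv', evolution_add_nat_mul_period hA hper]
    refine (norm_evolution_le hA hK _ ⟨hs0, hsT.le⟩).trans ?_
    gcongr
  have step2 : ‖((monodromy hA T) ^ n) (v 0)‖ ≤ max C 0 * r ^ n * ‖v 0‖ :=
    (hM n (v 0)).trans (by gcongr; exact le_max_left _ _)
  have hpow := (pow_bounds_of_abs_sub_le_one hr hT hn).2
  calc ‖v (s + n * T)‖ ≤ max C 0 * r ^ n * ‖v 0‖ * Real.exp (K * T) :=
        step1.trans (mul_le_mul_of_nonneg_right step2 (Real.exp_pos _).le)
    _ ≤ max C 0 * (Real.exp |Real.log r| * Real.exp (Real.log r / T * (s + n * T))) * ‖v 0‖ *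
          Real.exp (K * T) := by gcongr
    _ = max C 0 * Real.exp (K * T) * Real.exp |Real.log r| * ‖v 0‖ *
          Real.exp (Real.log r / T * (s + n * T)) := by ring

end Monodromy

end Floquet

end Literature.Analysis.ODE
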